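import Literature.Analysis.Matrix.SingularValueVerificationBounds
import Literature.ComputerArithmetic.Rump2006.CholeskyPositiveDefinite
import HarnessLib

/-!
# Verified error bounds for general sparse linear systems through a split `P_r A P_c ≈ F₁F₂` (Rump 2026, Part I, (1.2))

HONEST FRAMING (cell `certnum`, CERTIFIED-NUMERICS STACK, D-0105 (6); layer L4 = Lean soundness
statements per certificate kind). This is the soundness statement of the `sparse-lu-split/1` witness of
`cap.ila.gen` (certnum-ila-1; certificate `ila-lss/1`, method `sparse-lu`): a general (unsymmetric /
symmetric-indefinite) sparse `A` is verified nonsingular, and ANY approximate solution `x̃` of `Ax = b`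
gets `‖A⁻¹b − x̃‖₂ ≤ ‖b − Ax̃‖₂/σ_lo`, from the LU route that Rump describes in the introduction of
Part I:

> For general symmetric sparse matrix, a factorization `A ≈ L̃₁L̃₂ᵀ` … and similarly `A ≈ L̃M̃ᵀ` for
> general `A` with computing `L̃` and `M̃` by an LU-decomposition. Lower bounds of `σ_min(A)` follow by
> (1.2) `σ_min(A) ≥ σ_min(L̃₁)σ_min(L̃₂) − ‖A − L̃₁L̃₂ᵀ‖₂` … where the lower bounds on the smallest
> singular value of the factors follow by applying (1.1) to `L̃₁ᵀL̃₁ − s̃I` and so forth.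
> [Rump2026SparseI, §1, (1.1)–(1.2), p. 2; «If `σ_min(A) ≥ α > 0`, then `A` is nonsingular, and …
> `‖A⁻¹b − x̃‖_∞ ≤ ‖A⁻¹b − x̃‖₂ ≤ α⁻¹‖b − Ax̃‖₂`», p. 2]

read on the page (`paper:url-16a6c3477380` = the author's copy of Part I: (1.1)/(1.2) p0002, (1.8)/(1.9)
and (1.10) p0006, Lemma 2.3 p0009, Section 3 (equilibration `B := RPAC`, `A⁻¹b = Cy for By = c`;
`RᵀR ≈ PᵀAP`) p0015, Table 2 + (4.1) p0017–p0018, Theorem 6.1 (6.1) p0021, (8.2) p0026).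

WHAT IS TYPED (all PROVED; the chain's links are CITED from the tree, nothing is restated):
* `norm_toLp_mulVec_le_sqrt_of_abs_le_collatz` — (1.8), Collatz form: an entrywise majorant
  `|E| ≤ W` and a positive `x` with `(Wᵀ(Wx))_k ≤ θ x_k` give `‖Ev‖₂ ≤ √θ‖v‖₂` (how the kernel bounds
  `‖P_rAP_c − F₁F₂‖₂` from the float residual and its companion product: `_collatz_norm2_up`);
* `abs_quadForm_le_of_abs_le_collatz` — (1.9), the symmetric form `|vᵀΔv| ≤ θ‖v‖₂²`;
  `abs_quadForm_le_of_norm_mulVec_le` — Cauchy–Schwarz bridge from a 2-norm bound to the form bound;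
* `form_floor_of_shifted_factor_residual` — Theorem 6.1 (6.1) against the EXACT Gram matrix `G`
  (the kernel's a-posteriori «stage-2» floor): `|vᵀ(LLᵀ − (G − sI))v| ≤ θ‖v‖₂²` ⟹
  `(s − θ)‖v‖₂² ≤ vᵀGv`, no accuracy of `L` presumed;
* `sigma_lower_of_gram_form_floor`, `…_transpose` — «apply (1.1) to `FᵀF`»: a quadratic-form floor of
  `FᵀF` (resp. `FFᵀ`, square) is a floor `l‖v‖₂ ≤ ‖Fv‖₂` of `σ_min(F)`;
* `sigma_lower_of_submatrix_equiv` — a floor of `σ_min` of the row/column PERMUTED matrix is one of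
  `A` (Section 3: the factorisations are of `A(p, q)`);
* `sigma_lower_of_lu_split` / `lu_split_solution_bound` — THE COMPOSITION (1.2): Gram floors `l₁`, `l₂`
  of `F₁F₁ᵀ` and `F₂ᵀF₂`, `|A(p,q) − F₁F₂| ≤ W`, Collatz `α`, `α < l₁l₂` ⟹ `A` nonsingular and
  `‖A⁻¹b − x̃‖_∞ ≤ ‖A⁻¹b − x̃‖₂ ≤ ‖b − Ax̃‖₂/(l₁l₂ − α)` for every `b`, `x̃`;
* `abs_inv_mulVec_sub_le_staggered` — (4.1), the staggered correction `|A⁻¹b − x̃| ≤ |ỹ| + ‖ϱ‖₂/s`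
  entrywise from `|Ax̃ + Aỹ − b| ≤ ϱ`; `norm_toLp_inv_mulVec_sub_add_le_split` — the kernel's form with
  a rounded residual `r̂ ≈ b − Ax̃`: `‖A⁻¹b − (x̃ + ỹ)‖₂ ≤ (‖r̂ − Aỹ‖₂ + ‖(b − Ax̃) − r̂‖₂)/s`;
* `inv_mulVec_eq_diagonal_equilibrate` — Section 3: power-of-two equilibration is undone exactly,
  `A⁻¹b = D_c((D_rAD_c)⁻¹(D_rb))`.

Tree links used: `Literature.Analysis.Matrix.SingularValueVerification.{sigma_lower_mul (Rump 1993
p. 12), lower_bound_of_perturbation ((1.10)), isUnit_det_of_sigma_lower, norm_toLp_inv_mulVec_sub_le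
(Rump 1999 (11)), sigma_lower_of_transpose, pi_norm_le_norm_toLp, abs_apply_le_norm_toLp}` and
`Literature.ComputerArithmetic.Rump2006.quadForm_le_of_mulVec_le` (Collatz quadratic-form bound).

WHAT IS NOT CERTIFIED BY THESE STATEMENTS: how `W`, `θ`, `r̂`, the Gram floors `l₁, l₂` are OBTAINED
in floating point (that is `FloatAccumulationCertificate` p477122, `Rump2026SparseI.SparseCholesky*`
F1-13 and the kernel's directed rounding — hypotheses here); the library hypotheses H-SPMM / H-CHOL /
H-IEEE of `cap.ila.gen`; success (`α < l₁l₂`) — failure is `NotVerified`, never a bound.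
-/

open Finset Matrix WithLp
open Literature.Analysis.Matrix.SingularValueVerification
open Literature.ComputerArithmetic.Rump2006

namespace Literature.Analysis.Matrix.SparseLUSplit

variable {n : ℕ}

/-! ### §1 Collatz bounds for the spectral norm ((1.8), (1.9)) -/

/-- The Euclidean norm is monotone under entrywise domination `|u_i| ≤ ρ_i` (the step
`‖b − Ax̃ − Aỹ‖₂ ≤ ‖ϱ‖₂` of (4.1)). [cite: Rump2026SparseI, Section 4 (4.1)] -/
theorem norm_toLp_le_of_abs_le {u ρ : Fin n → ℝ} (h : ∀ i, |u i| ≤ ρ i) :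
    ‖toLp 2 u‖ ≤ ‖toLp 2 ρ‖ := by
  have h2 : ‖toLp 2 u‖ ^ 2 ≤ ‖toLp 2 ρ‖ ^ 2 := by
    rw [norm_toLp_sq, norm_toLp_sq]
    refine sum_le_sum fun i _ => ?_
    calc u i ^ 2 = |u i| ^ 2 := (sq_abs _).symm
      _ ≤ ρ i ^ 2 := pow_le_pow_left₀ (abs_nonneg _) (h i) 2
  have h3 := Real.sqrt_le_sqrt h2
  rwa [Real.sqrt_sq (norm_nonneg _), Real.sqrt_sq (norm_nonneg _)] at h3

/-- **(1.8), Collatz form — a rigorous upper bound of `‖E‖₂` from an entrywise majorant.** If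
`|E_{ij}| ≤ W_{ij}` and, for some positive vector `x` and `θ`, `(Wᵀ(Wx))_k ≤ θ x_k` for all `k`, then
`‖Ev‖₂ ≤ √θ·‖v‖₂` for every `v` (`‖E‖₂ ≤ ‖|E|‖₂ ≤ ‖W‖₂ = √λ_max(WᵀW) ≤ √(max_k (Wᵀ(Wx))_k/x_k)`,
Perron–Frobenius; no eigenvalue is computed).
[cite: Rump2026SparseI, Section 1 (1.8)] [cite: Rump2010Verification, (10.61)] -/
theorem norm_toLp_mulVec_le_sqrt_of_abs_le_collatz {E W : Matrix (Fin n) (Fin n) ℝ}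
    (hW : ∀ i j, |E i j| ≤ W i j) {x : Fin n → ℝ} (hx : ∀ i, 0 < x i) {θ : ℝ}
    (hθ : ∀ k, (Wᵀ *ᵥ (W *ᵥ x)) k ≤ θ * x k) (v : Fin n → ℝ) :
    ‖toLp 2 (E *ᵥ v)‖ ≤ √θ * ‖toLp 2 v‖ := by
  set a : Fin n → ℝ := fun i => |v i| with ha
  have hW0 : ∀ i j, 0 ≤ W i j := fun i j => (abs_nonneg _).trans (hW i j)
  -- entrywise `|(Ev)_i| ≤ (W|v|)_i`
  have h1 : ∀ i, |(E *ᵥ v) i| ≤ (W *ᵥ a) i := fun i => by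
    simp only [mulVec, dotProduct]
    refine (abs_sum_le_sum_abs _ _).trans (sum_le_sum fun j _ => ?_)
    rw [abs_mul]
    exact mul_le_mul_of_nonneg_right (hW i j) (abs_nonneg _)
  -- `‖Ev‖₂² ≤ ‖W|v|‖₂² = |v|ᵀ(WᵀW)|v| ≤ θ·|v|ᵀ|v| = θ‖v‖₂²`
  have h2 : ‖toLp 2 (E *ᵥ v)‖ ^ 2 ≤ ‖toLp 2 (W *ᵥ a)‖ ^ 2 :=
    pow_le_pow_left₀ (norm_nonneg _) (norm_toLp_le_of_abs_le h1) 2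
  have h3 : ‖toLp 2 (W *ᵥ a)‖ ^ 2 = a ⬝ᵥ ((Wᵀ * W) *ᵥ a) := by
    rw [CholeskyRun.dotProduct_transpose_mul_self_mulVec, dotProduct_self_eq_norm_toLp_sq]
  have hN : (Wᵀ * W)ᵀ = Wᵀ * W := by rw [transpose_mul, transpose_transpose]
  have hN0 : ∀ i j, 0 ≤ (Wᵀ * W) i j := fun i j => by
    rw [mul_apply]
    exact sum_nonneg fun k _ => by rw [transpose_apply]; exact mul_nonneg (hW0 k i) (hW0 k j)
  have hs : ∀ i, ((Wᵀ * W) *ᵥ x) i ≤ θ * x i := fun i => by rw [← mulVec_mulVec]; exact hθ i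
  have h4 := quadForm_le_of_mulVec_le hN hN0 hx hs a
  have h5 : a ⬝ᵥ a = ‖toLp 2 v‖ ^ 2 := by
    rw [norm_toLp_sq]
    exact sum_congr rfl fun i _ => by rw [ha, abs_mul_abs_self, sq]
  have h6 : ‖toLp 2 (E *ᵥ v)‖ ^ 2 ≤ θ * ‖toLp 2 v‖ ^ 2 := by
    rw [← h5]; exact h2.trans (h3 ▸ h4)
  have h7 := Real.abs_le_sqrt h6
  rwa [abs_of_nonneg (norm_nonneg _), Real.sqrt_mul' _ (sq_nonneg _),
    Real.sqrt_sq (norm_nonneg _)] at h7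

/-- **(1.9), Collatz form for a symmetric majorant**: `|Δ_{ij}| ≤ W_{ij}`, `W` symmetric, `x > 0` with
`(Wx)_k ≤ θ x_k` ⟹ `|vᵀΔv| ≤ θ‖v‖₂²` for every `v` (`ϱ(Δ) ≤ ϱ(|Δ|) ≤ ‖W‖₂ ≤ max_k (Wx)_k/x_k`).
[cite: Rump2026SparseI, Section 1 (1.9)] [cite: Rump2006, Lemma 2.6] -/
theorem abs_quadForm_le_of_abs_le_collatz {Δ W : Matrix (Fin n) (Fin n) ℝ}
    (hW : ∀ i j, |Δ i j| ≤ W i j) (hWs : Wᵀ = W) {x : Fin n → ℝ} (hx : ∀ i, 0 < x i) {θ : ℝ}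
    (hθ : ∀ k, (W *ᵥ x) k ≤ θ * x k) (v : Fin n → ℝ) :
    |v ⬝ᵥ (Δ *ᵥ v)| ≤ θ * (v ⬝ᵥ v) := by
  set a : Fin n → ℝ := fun i => |v i| with ha
  have hW0 : ∀ i j, 0 ≤ W i j := fun i j => (abs_nonneg _).trans (hW i j)
  have h1 : |v ⬝ᵥ (Δ *ᵥ v)| ≤ a ⬝ᵥ (W *ᵥ a) := by
    simp only [dotProduct, mulVec]
    refine (abs_sum_le_sum_abs _ _).trans (sum_le_sum fun i _ => ?_)
    rw [abs_mul, ha]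
    refine mul_le_mul_of_nonneg_left ((abs_sum_le_sum_abs _ _).trans
      (sum_le_sum fun j _ => ?_)) (abs_nonneg _)
    rw [abs_mul]
    exact mul_le_mul_of_nonneg_right (hW i j) (abs_nonneg _)
  have h2 := quadForm_le_of_mulVec_le hWs hW0 hx hθ a
  have h3 : a ⬝ᵥ a = v ⬝ᵥ v := sum_congr rfl fun i _ => by rw [ha, abs_mul_abs_self]
  rw [h3] at h2
  exact h1.trans h2

/-- From a 2-norm bound to a quadratic-form bound (Cauchy–Schwarz): `‖Δv‖₂ ≤ t‖v‖₂` for all `v`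
⟹ `|vᵀΔv| ≤ t‖v‖₂²` for all `v` — so the (1.8) Collatz bound (any majorant `W`, via `WᵀW`) also feeds
`form_floor_of_shifted_factor_residual` when the residual's majorant is not symmetric.
[cite: Rump2026SparseI, Theorem 6.1 (proof: `λ_min(R̃ᵀR̃ − ΔB) ≥ −‖ΔB‖₂`)] -/
theorem abs_quadForm_le_of_norm_mulVec_le {Δ : Matrix (Fin n) (Fin n) ℝ} {t : ℝ}
    (h : ∀ v, ‖toLp 2 (Δ *ᵥ v)‖ ≤ t * ‖toLp 2 v‖) (v : Fin n → ℝ) :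
    |v ⬝ᵥ (Δ *ᵥ v)| ≤ t * (v ⬝ᵥ v) := by
  rw [dotProduct_self_eq_norm_toLp_sq]
  calc |v ⬝ᵥ (Δ *ᵥ v)| ≤ ‖toLp 2 v‖ * ‖toLp 2 (Δ *ᵥ v)‖ := abs_dotProduct_le _ _
    _ ≤ ‖toLp 2 v‖ * (t * ‖toLp 2 v‖) := mul_le_mul_of_nonneg_left (h v) (norm_nonneg _)
    _ = t * ‖toLp 2 v‖ ^ 2 := by ring

/-! ### §2 Floors for `σ_min` of the factors from their Gram matrices ((1.1), Theorem 6.1) -/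

/-- **Theorem 6.1 (6.1), a-posteriori form against the EXACT Gram matrix** (the kernel's stage-2
floor): for ANY `G`, ANY factor `L` (no accuracy presumed) and a shift `s`, if the residual
`Δ := LLᵀ − (G − sI)` satisfies `|vᵀΔv| ≤ θ‖v‖₂²` for all `v` (e.g. by
`abs_quadForm_le_of_abs_le_collatz`), then `(s − θ)‖v‖₂² ≤ vᵀGv` for all `v`:
`λ_min(G) ≥ s − ‖Δ‖₂`. [cite: Rump2026SparseI, Theorem 6.1 (6.1)] [cite: Rump2026SparseI, Section 1 (1.1)] -/
theorem form_floor_of_shifted_factor_residual {k : ℕ} (G : Matrix (Fin n) (Fin n) ℝ)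
    (L : Matrix (Fin n) (Fin k) ℝ) {s θ : ℝ}
    (hΔ : ∀ v, |v ⬝ᵥ ((L * Lᵀ - (G - s • (1 : Matrix (Fin n) (Fin n) ℝ))) *ᵥ v)| ≤ θ * (v ⬝ᵥ v))
    (v : Fin n → ℝ) : (s - θ) * (v ⬝ᵥ v) ≤ v ⬝ᵥ (G *ᵥ v) := by
  have h1 : v ⬝ᵥ ((L * Lᵀ - (G - s • (1 : Matrix (Fin n) (Fin n) ℝ))) *ᵥ v) =
      v ⬝ᵥ ((L * Lᵀ) *ᵥ v) - v ⬝ᵥ (G *ᵥ v) + s * (v ⬝ᵥ v) := by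
    rw [sub_mulVec, sub_mulVec, smul_mulVec, one_mulVec, dotProduct_sub, dotProduct_sub,
      dotProduct_smul, smul_eq_mul]
    ring
  have h2 : 0 ≤ v ⬝ᵥ ((L * Lᵀ) *ᵥ v) := by
    rw [← mulVec_mulVec, dotProduct_mulVec v L, ← mulVec_transpose]
    exact sum_nonneg fun i _ => mul_self_nonneg _
  have h3 := (abs_le.mp (hΔ v)).2
  rw [h1] at h3
  linarith

/-- **«Apply (1.1) to `FᵀF`»**: a quadratic-form floor `l²‖v‖₂² ≤ vᵀ(FᵀF)v` (`l ≥ 0`) of the Gram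
matrix is the floor `l‖v‖₂ ≤ ‖Fv‖₂` of `σ_min(F)` — since `vᵀFᵀFv = ‖Fv‖₂²`.
[cite: Rump2026SparseI, Section 1 (1.2) («the lower bounds on the smallest singular value of the factors follow by applying (1.1) to L̃₁ᵀL̃₁ − s̃I»)] [cite: Rump1993, Theorem 2.1] -/
theorem sigma_lower_of_gram_form_floor (F : Matrix (Fin n) (Fin n) ℝ) {l : ℝ} (hl : 0 ≤ l)
    (h : ∀ v, l ^ 2 * (v ⬝ᵥ v) ≤ v ⬝ᵥ ((Fᵀ * F) *ᵥ v)) (v : Fin n → ℝ) :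
    l * ‖toLp 2 v‖ ≤ ‖toLp 2 (F *ᵥ v)‖ := by
  have h1 := h v
  rw [CholeskyRun.dotProduct_transpose_mul_self_mulVec, dotProduct_self_eq_norm_toLp_sq,
    dotProduct_self_eq_norm_toLp_sq, ← mul_pow] at h1
  have h2 := Real.sqrt_le_sqrt h1
  rwa [Real.sqrt_sq (mul_nonneg hl (norm_nonneg _)), Real.sqrt_sq (norm_nonneg _)] at h2

/-- The same for the OTHER Gram form of a square factor: `l²‖v‖₂² ≤ vᵀ(FFᵀ)v` for all `v` (`l ≥ 0`)
⟹ `l‖v‖₂ ≤ ‖Fv‖₂` for all `v` (`σ_min(F) = σ_min(Fᵀ)`; tree: `sigma_lower_of_transpose`).  This is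
the form whose exact Cholesky factor is a lower-triangular `F` itself (zero fill, natural ordering).
[cite: Rump2026SparseI, Section 1 (1.2) with Section 8 (8.2) (`σ_min(L₁L₁ᵀ)`)] [cite: Rump1993, Theorem 2.1] -/
theorem sigma_lower_of_gram_form_floor_transpose (F : Matrix (Fin n) (Fin n) ℝ) {l : ℝ} (hl : 0 ≤ l)
    (h : ∀ v, l ^ 2 * (v ⬝ᵥ v) ≤ v ⬝ᵥ ((F * Fᵀ) *ᵥ v)) (v : Fin n → ℝ) :
    l * ‖toLp 2 v‖ ≤ ‖toLp 2 (F *ᵥ v)‖ := by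
  have hT : ∀ w, l * ‖toLp 2 w‖ ≤ ‖toLp 2 (Fᵀ *ᵥ w)‖ :=
    sigma_lower_of_gram_form_floor Fᵀ hl (by rw [transpose_transpose]; exact h)
  rcases hl.eq_or_lt with hl0 | hlpos
  · rw [← hl0, zero_mul]; exact norm_nonneg _
  · exact sigma_lower_of_transpose hlpos hT v

/-! ### §3 Permutations and the composed bound (1.2) -/

/-- A floor of `σ_min` survives a simultaneous row/column permutation: if `s‖v‖₂ ≤ ‖A(p,q)v‖₂` for all
`v`, where `A(p,q)_{ij} = a_{σ i, τ j}`, then `s‖w‖₂ ≤ ‖Aw‖₂` for all `w` (the factorisations of the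
method are of the permuted matrix, `RᵀR ≈ PᵀAP`, `LDLᵀ ≈ A(p,p)`, `B := RPAC`).
[cite: Rump2026SparseI, Section 3 ((3.3)–(3.5))] -/
theorem sigma_lower_of_submatrix_equiv {A : Matrix (Fin n) (Fin n) ℝ} (σ τ : Fin n ≃ Fin n) {s : ℝ}
    (h : ∀ v, s * ‖toLp 2 v‖ ≤ ‖toLp 2 (A.submatrix σ τ *ᵥ v)‖) (w : Fin n → ℝ) :
    s * ‖toLp 2 w‖ ≤ ‖toLp 2 (A *ᵥ w)‖ := by
  have hn : ∀ (u : Fin n → ℝ) (e : Fin n ≃ Fin n), ‖toLp 2 (u ∘ e)‖ = ‖toLp 2 u‖ := fun u e => by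
    have hsq : ‖toLp 2 (u ∘ e)‖ ^ 2 = ‖toLp 2 u‖ ^ 2 := by
      rw [norm_toLp_sq, norm_toLp_sq]
      exact Equiv.sum_comp e (fun i => u i ^ 2)
    calc ‖toLp 2 (u ∘ e)‖ = √(‖toLp 2 (u ∘ e)‖ ^ 2) := (Real.sqrt_sq (norm_nonneg _)).symm
      _ = √(‖toLp 2 u‖ ^ 2) := by rw [hsq]
      _ = ‖toLp 2 u‖ := Real.sqrt_sq (norm_nonneg _)
  have h1 := h (w ∘ τ)
  have e1 : (w ∘ τ) ∘ τ.symm = w := by funext i; simp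
  rw [submatrix_mulVec_equiv, e1, hn (A *ᵥ w) σ, hn w τ] at h1
  exact h1

/-- **(1.2) for a split of the permuted matrix, as a floor of `σ_min(A)`**: floors `l₁‖v‖₂ ≤ ‖F₁v‖₂`,
`l₂‖v‖₂ ≤ ‖F₂v‖₂` (`l₁ ≥ 0`), an entrywise majorant `|A(p,q) − F₁F₂| ≤ W` with a Collatz pair
`(Wᵀ(Wx))_k ≤ α² x_k`, `x > 0`, `α ≥ 0` ⟹ `(l₁l₂ − α)‖v‖₂ ≤ ‖Av‖₂` for all `v`
(`σ_min(A) = σ_min(A(p,q)) ≥ σ_min(F₁F₂) − ‖A(p,q) − F₁F₂‖₂ ≥ σ_min(F₁)σ_min(F₂) − α`).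
[cite: Rump2026SparseI, Section 1 (1.2) and (1.10)] [cite: Rump1993, Theorem 2.3 and p. 12] -/
theorem sigma_lower_of_lu_split {A F₁ F₂ W : Matrix (Fin n) (Fin n) ℝ} (σr σc : Fin n ≃ Fin n)
    {l₁ l₂ α : ℝ} (hl₁ : 0 ≤ l₁)
    (hF₁ : ∀ v, l₁ * ‖toLp 2 v‖ ≤ ‖toLp 2 (F₁ *ᵥ v)‖) (hF₂ : ∀ v, l₂ * ‖toLp 2 v‖ ≤ ‖toLp 2 (F₂ *ᵥ v)‖)
    (hW : ∀ i j, |(A.submatrix σr σc - F₁ * F₂) i j| ≤ W i j)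
    {x : Fin n → ℝ} (hx : ∀ i, 0 < x i) (hα0 : 0 ≤ α) (hα : ∀ k, (Wᵀ *ᵥ (W *ᵥ x)) k ≤ α ^ 2 * x k)
    (v : Fin n → ℝ) : (l₁ * l₂ - α) * ‖toLp 2 v‖ ≤ ‖toLp 2 (A *ᵥ v)‖ := by
  have hprod := sigma_lower_mul hl₁ hF₁ hF₂
  have hW' : ∀ i j, |(F₁ * F₂ - A.submatrix σr σc) i j| ≤ W i j := fun i j => by
    rw [← neg_sub, neg_apply, abs_neg]; exact hW i j
  have hE : ∀ w, ‖toLp 2 ((F₁ * F₂ - A.submatrix σr σc) *ᵥ w)‖ ≤ α * ‖toLp 2 w‖ := fun w => by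
    have := norm_toLp_mulVec_le_sqrt_of_abs_le_collatz hW' hx hα w
    rwa [Real.sqrt_sq hα0] at this
  have hB : ∀ w, (l₁ * l₂ - α) * ‖toLp 2 w‖ ≤ ‖toLp 2 (A.submatrix σr σc *ᵥ w)‖ :=
    lower_bound_of_perturbation (N := fun w => ‖toLp 2 w‖) (At := F₁ * F₂) (A := A.submatrix σr σc)
      (fun u w => by rw [toLp_add]; exact norm_add_le _ _) hprod hE
  exact sigma_lower_of_submatrix_equiv σr σc hB v

/-- **The `sparse-lu-split/1` soundness statement** ((1.2) with the Gram floors and p. 2): from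
* Gram floors `l₁²‖v‖₂² ≤ vᵀ(F₁F₁ᵀ)v` and `l₂²‖v‖₂² ≤ vᵀ(F₂ᵀF₂)v` for all `v` (`l₁, l₂ ≥ 0`; the two
  embedded `λ_min` certificates of the Gram matrices, in either of their forms — for the `F₂F₂ᵀ` form
  convert with `sigma_lower_of_gram_form_floor_transpose` and use `sigma_lower_of_lu_split`),
* an entrywise residual majorant `|A(p,q) − F₁F₂| ≤ W` of the permuted matrix `A(p,q)_{ij} = a_{σr i, σc j}`
  and a Collatz pair `x > 0`, `(Wᵀ(Wx))_k ≤ α² x_k`, `α ≥ 0`,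
* the gap `α < l₁l₂`,

`A` is nonsingular and for EVERY right-hand side `b` and EVERY `x̃`:
`‖A⁻¹b − x̃‖_∞ ≤ ‖A⁻¹b − x̃‖₂ ≤ ‖b − Ax̃‖₂ / (l₁l₂ − α)`.
[cite: Rump2026SparseI, Section 1 (1.2) and p. 2 («σ_min(A) ≥ α > 0 ⟹ A nonsingular and ‖A⁻¹b − x̃‖_∞ ≤ ‖A⁻¹b − x̃‖₂ ≤ α⁻¹‖b − Ax̃‖₂»)] [cite: Rump1993, Theorem 2.3] -/
theorem lu_split_solution_bound {A F₁ F₂ W : Matrix (Fin n) (Fin n) ℝ} (σr σc : Fin n ≃ Fin n)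
    {l₁ l₂ α : ℝ} (hl₁ : 0 ≤ l₁) (hl₂ : 0 ≤ l₂)
    (h₁ : ∀ v, l₁ ^ 2 * (v ⬝ᵥ v) ≤ v ⬝ᵥ ((F₁ * F₁ᵀ) *ᵥ v))
    (h₂ : ∀ v, l₂ ^ 2 * (v ⬝ᵥ v) ≤ v ⬝ᵥ ((F₂ᵀ * F₂) *ᵥ v))
    (hW : ∀ i j, |(A.submatrix σr σc - F₁ * F₂) i j| ≤ W i j)
    {x : Fin n → ℝ} (hx : ∀ i, 0 < x i) (hα0 : 0 ≤ α) (hα : ∀ k, (Wᵀ *ᵥ (W *ᵥ x)) k ≤ α ^ 2 * x k)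
    (hgap : α < l₁ * l₂) :
    IsUnit A.det ∧ ∀ b xt : Fin n → ℝ,
      ‖A⁻¹ *ᵥ b - xt‖ ≤ ‖toLp 2 (A⁻¹ *ᵥ b - xt)‖ ∧
        ‖toLp 2 (A⁻¹ *ᵥ b - xt)‖ ≤ ‖toLp 2 (b - A *ᵥ xt)‖ / (l₁ * l₂ - α) := by
  have hA := sigma_lower_of_lu_split σr σc hl₁ (sigma_lower_of_gram_form_floor_transpose F₁ hl₁ h₁)
    (sigma_lower_of_gram_form_floor F₂ hl₂ h₂) hW hx hα0 hα
  have hpos : 0 < l₁ * l₂ - α := sub_pos.mpr hgap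
  exact ⟨isUnit_det_of_sigma_lower hpos hA, fun b xt =>
    ⟨pi_norm_le_norm_toLp _, norm_toLp_inv_mulVec_sub_le hpos hA b xt⟩⟩

/-! ### §4 The residual iteration (Table 2, (4.1)) and the equilibration -/

/-- **(4.1), staggered correction**: with a floor `0 < s ≤ σ_min(A)` (`s‖v‖₂ ≤ ‖Av‖₂` for all `v`),
an approximate solution `x̃`, a correction `ỹ` and ANY entrywise bound `|Ax̃ + Aỹ − b| ≤ ϱ`:
`|A⁻¹b − x̃|_i ≤ |ỹ_i| + ‖ϱ‖₂/s` for every `i`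
(`A⁻¹b − x̃ = ỹ + A⁻¹(b − Ax̃ − Aỹ)` and `‖A⁻¹(·)‖₂ ≤ σ_min(A)⁻¹‖ϱ‖₂`).
[cite: Rump2026SparseI, Section 4 (4.1) and Table 2] -/
theorem abs_inv_mulVec_sub_le_staggered {A : Matrix (Fin n) (Fin n) ℝ} {s : ℝ} (hs : 0 < s)
    (hA : ∀ v, s * ‖toLp 2 v‖ ≤ ‖toLp 2 (A *ᵥ v)‖) (b xt yt ρ : Fin n → ℝ)
    (hρ : ∀ i, |(A *ᵥ xt + A *ᵥ yt - b) i| ≤ ρ i) (i : Fin n) :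
    |(A⁻¹ *ᵥ b - xt) i| ≤ |yt i| + ‖toLp 2 ρ‖ / s := by
  have h1 : A⁻¹ *ᵥ b - xt = yt + (A⁻¹ *ᵥ b - (xt + yt)) := by abel
  have h2 := norm_toLp_inv_mulVec_sub_le hs hA b (xt + yt)
  have h3 : ‖toLp 2 (b - A *ᵥ (xt + yt))‖ ≤ ‖toLp 2 ρ‖ := by
    refine norm_toLp_le_of_abs_le fun j => ?_
    have e : (b - A *ᵥ (xt + yt)) j = -((A *ᵥ xt + A *ᵥ yt - b) j) := by
      rw [mulVec_add]; simp only [Pi.sub_apply, Pi.add_apply]; ring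
    rw [e, abs_neg]; exact hρ j
  have h4 : |(A⁻¹ *ᵥ b - (xt + yt)) i| ≤ ‖toLp 2 ρ‖ / s :=
    (abs_apply_le_norm_toLp _ i).trans (h2.trans (div_le_div_of_nonneg_right h3 hs.le))
  calc |(A⁻¹ *ᵥ b - xt) i| = |yt i + (A⁻¹ *ᵥ b - (xt + yt)) i| := by rw [h1]; rfl
    _ ≤ |yt i| + |(A⁻¹ *ᵥ b - (xt + yt)) i| := abs_add_le _ _
    _ ≤ |yt i| + ‖toLp 2 ρ‖ / s := by linarith

/-- **The kernel's form of one correction round**: with a floor `0 < s ≤ σ_min(A)`, an approximate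
solution `X`, a ROUNDED residual `r̂ ≈ r := b − AX` and the correction `Y ≈ A⁻¹r̂`:
`‖A⁻¹b − (X + Y)‖₂ ≤ (‖r̂ − AY‖₂ + ‖(b − AX) − r̂‖₂)/s` (so entrywise as well, by
`abs_apply_le_norm_toLp`) — `x* − X − Y = A⁻¹(r − AY)` and `r − AY = (r̂ − AY) + (r − r̂)`.
[cite: Rump2026SparseI, Section 4 (4.1) and Table 2 (lines 2–4)] -/
theorem norm_toLp_inv_mulVec_sub_add_le_split {A : Matrix (Fin n) (Fin n) ℝ} {s : ℝ} (hs : 0 < s)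
    (hA : ∀ v, s * ‖toLp 2 v‖ ≤ ‖toLp 2 (A *ᵥ v)‖) (b X Y rh : Fin n → ℝ) :
    ‖toLp 2 (A⁻¹ *ᵥ b - (X + Y))‖ ≤
      (‖toLp 2 (rh - A *ᵥ Y)‖ + ‖toLp 2 ((b - A *ᵥ X) - rh)‖) / s := by
  have h2 := norm_toLp_inv_mulVec_sub_le hs hA b (X + Y)
  have h3 : b - A *ᵥ (X + Y) = (rh - A *ᵥ Y) + ((b - A *ᵥ X) - rh) := by rw [mulVec_add]; abel
  have h4 : ‖toLp 2 (b - A *ᵥ (X + Y))‖ ≤ ‖toLp 2 (rh - A *ᵥ Y)‖ + ‖toLp 2 ((b - A *ᵥ X) - rh)‖ := by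
    rw [h3, toLp_add]; exact norm_add_le _ _
  exact h2.trans (div_le_div_of_nonneg_right h4 hs.le)

/-- With `|(r̂ − AY) − ŝ| ≤ e` entrywise for a rounded evaluation `ŝ` of `r̂ − AY` (directed rounding or
an error-free transformation supplies `e`), `‖r̂ − AY‖₂ ≤ ‖|ŝ| + e‖₂` — the number the kernel divides
by `s`. [cite: Rump2026SparseI, Section 4 (4.1) with Table 2 (lines 7–8)] -/
theorem norm_toLp_le_of_abs_sub_le {u sh e : Fin n → ℝ} (h : ∀ i, |u i - sh i| ≤ e i) :
    ‖toLp 2 u‖ ≤ ‖toLp 2 (fun i => |sh i| + e i)‖ :=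
  norm_toLp_le_of_abs_le fun i => by
    have := h i
    have h1 : u i = sh i + (u i - sh i) := by ring
    rw [h1]
    exact (abs_add_le _ _).trans (by linarith)

/-- **Equilibration is undone exactly** (Section 3: `B := RAC` with power-of-two diagonal scalings,
«it follows `A⁻¹b = Cy` for `By = c`», `c = Rb`): if `D_r = diag(d_r)`, `D_c = diag(d_c)` have nonzero
entries and `D_rAD_c` is nonsingular, then `A` is nonsingular and `A⁻¹b = D_c((D_rAD_c)⁻¹(D_rb))`;
in particular `(A⁻¹b)_i = (d_c)_i · y_i` for the solution `y` of the scaled system.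
[cite: Rump2026SparseI, Section 3 ((3.2)–(3.3))] -/
theorem inv_mulVec_eq_diagonal_equilibrate {A : Matrix (Fin n) (Fin n) ℝ} {dr dc : Fin n → ℝ}
    (hdr : ∀ i, dr i ≠ 0) (hdc : ∀ i, dc i ≠ 0)
    (hB : IsUnit (diagonal dr * A * diagonal dc).det) (b : Fin n → ℝ) :
    IsUnit A.det ∧
      A⁻¹ *ᵥ b = diagonal dc *ᵥ ((diagonal dr * A * diagonal dc)⁻¹ *ᵥ (diagonal dr *ᵥ b)) := by
  have hDr : IsUnit (diagonal dr).det := by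
    rw [det_diagonal, isUnit_iff_ne_zero]; exact prod_ne_zero_iff.mpr fun i _ => hdr i
  have hDc : IsUnit (diagonal dc).det := by
    rw [det_diagonal, isUnit_iff_ne_zero]; exact prod_ne_zero_iff.mpr fun i _ => hdc i
  have hA : IsUnit A.det := by
    rw [det_mul, det_mul] at hB
    exact isUnit_of_mul_isUnit_right (isUnit_of_mul_isUnit_left hB)
  refine ⟨hA, ?_⟩
  rw [Matrix.mul_inv_rev, Matrix.mul_inv_rev, mulVec_mulVec, mulVec_mulVec, ← mul_assoc, ← mul_assoc,
    mul_nonsing_inv _ hDc, one_mul, mul_assoc, nonsing_inv_mul _ hDr, mul_one]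


/-! ### Append 2026-08-27 (certnum-lean-1 g4): from the round bound to the certificate's CLAIM `xm ± xr`

The `ila-lss/1` certificate states an ENTRYWISE enclosure `x* ∈ xm ± xr`.  After a correction round the kernel holds
`‖y* − (X + Y)‖₂ ≤ δ` (`norm_toLp_inv_mulVec_sub_add_le_split`), re-centres the unevaluated sum `X + Y = Xn + T`
EXACTLY (TwoSum, [Rump2026SparseI, Table 2 lines 4 and 6, footnote 12]) and reports `xm := Xn` (resp. `D_c Xn` after
equilibration) with a radius `xr ≥ δ + |T|` (resp. `|d_c|·(δ + |T|)`; any slack factor `≥ 1` only widens it).  The two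
lemmas below are that last, purely arithmetic link. -/

/-- **Re-centring by an error-free transformation**: if `‖A⁻¹b − (X + Y)‖₂ ≤ δ` and `X + Y = Xn + T` entrywise
(exactly — `[Xn, T] = TwoSum(X, Y)`), then `|(A⁻¹b)_i − Xn_i| ≤ δ + |T_i|` for every `i`: the certificate's claim
`x* ∈ Xn ± xr` holds for every `xr ≥ δ + |T|`. [cite: Rump2026SparseI, Section 4 Table 2 (lines 4, 6, 9) with (4.1)] -/
theorem abs_inv_mulVec_sub_le_of_twoSum {A : Matrix (Fin n) (Fin n) ℝ} {b X Y Xn T : Fin n → ℝ} {δ : ℝ}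
    (h : ‖toLp 2 (A⁻¹ *ᵥ b - (X + Y))‖ ≤ δ) (hsum : ∀ i, X i + Y i = Xn i + T i) (i : Fin n) :
    |(A⁻¹ *ᵥ b) i - Xn i| ≤ δ + |T i| := by
  have h1 : |(A⁻¹ *ᵥ b - (X + Y)) i| ≤ δ := (abs_apply_le_norm_toLp _ i).trans h
  have e : (A⁻¹ *ᵥ b) i - Xn i = (A⁻¹ *ᵥ b - (X + Y)) i + T i := by
    simp only [Pi.sub_apply, Pi.add_apply]
    linarith [hsum i]
  rw [e]
  exact (abs_add_le _ _).trans (by linarith)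

/-- **The claim in the ORIGINAL variables after power-of-two equilibration**: with `x* = D_c y*`
(`inv_mulVec_eq_diagonal_equilibrate`), an enclosure `|y*_i − Xn_i| ≤ ρ_i` of the scaled solution gives
`|x*_i − (d_c)_i·Xn_i| ≤ |(d_c)_i|·ρ_i` — the reported `xm = D_c Xn`, `xr ≥ |D_c| ρ`.
[cite: Rump2026SparseI, Section 3 ((3.2)–(3.3): «A⁻¹b = Cy for By = c»)] -/
theorem abs_diagonal_mulVec_sub_le {dc y Xn ρ : Fin n → ℝ} (h : ∀ i, |y i - Xn i| ≤ ρ i) (i : Fin n) :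
    |(diagonal dc *ᵥ y) i - dc i * Xn i| ≤ |dc i| * ρ i := by
  rw [mulVec_diagonal, ← mul_sub, abs_mul]
  exact mul_le_mul_of_nonneg_left (h i) (abs_nonneg _)

end Literature.Analysis.Matrix.SparseLUSplit
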